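import Summits.Ventures.CertifiedArithmetic.Expansions.Orient2dStageBBounds
import Mathlib.Tactic.Linarith
import Mathlib.Tactic.Positivity
import Mathlib.Tactic.Ring
import Mathlib.Tactic.NormNum

/-!
# ORIENT3D, stage B, part 1: the error analysis behind the stage-B test, constant left open

NEW WORK in the sense of this development: the algorithm, the shape of the test and the published
constant `o3derrboundB = (3 + 28ε)ε` are Shewchuk's (`predicates.c`, `orient3dadapt`; Table 3
p. 351, line B); the error analysis is ours — the paper prints line B without a derivation ("Error
bounds … are given in Table 3", p. 350).  Which constants the analysis certifies is the subject of
the companion file `Orient3dStageBMargins.lean` (it does NOT reproduce Shewchuk's 28 with the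
estimate error available to us; see there).

THE TEST.  After the stage-A filter falls through, `orient3dadapt` computes the nine differences
`x = (a ⊖ d, …)` in floating point, the expansion `fin1` with `Σ fin1 = B :=` the determinant of the
COMPUTED differences (exactly; `Orient3dStageBExpansion.lean`), `det = estimate(fin1)`,
`errbound = o3derrboundB ⊗ permanent` with the `permanent` of stage A
(`Σ_cyclic (|x_b ⊗ y_c| ⊕ |x_c ⊗ y_b|) ⊗ |z_a|`, five roundings deep), and returns `det` if
`det ≥ errbound ∨ −det ≥ errbound`.  For this to be sound, `det` must have the sign of the TRUE
determinant `T` (the same polynomial in the true differences `t = a − d, …`, `t = x ± ε|x|`).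

THE ANALYSIS (`orient3d_stageB_sign_of_bounds`, rationals only, the constant `K` and ESTIMATE's
relative error `δ` left as parameters).  With `Π` the exact permanent of the COMPUTED products
`P ≈ x·x'` (`|x·x' − P| ≤ ε|P|`):
`|T − B| ≤ (3ε + 3ε² + ε³)·Σ|z|(|x·x'| + |x″·x‴|) ≤ (3ε + 6ε² + 4ε³ + ε⁴)·Π`
(`cofactorB_sub_le_of_rel`: three factors perturbed by `ε` each); `errbound ≥ (1 − ε)⁵·K·Π`
(`orient3dPermanent_ge`, the chain of stage A); `|det − B| ≤ δ|B|` and the passed test give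
`(1 + δ)|B| ≥ |det| ≥ errbound`.  Hence `|T − B| < |B|` — and `B`, `det`, `T` share their sign —
as soon as THE MARGIN `(1 + δ)(3ε + 6ε² + 4ε³ + ε⁴) < (1 − ε)⁵·K` holds (for `K = (3 + Cε)ε`,
`δ = kε` it reads `ε²(C − 21 − 3k) + O(ε³) > 0`).  Also here: `pos_iff_and_neg_iff_of_abs_sub_lt`
(sign transfer from `|a − b| < |b|`).

References: J. R. Shewchuk, Discrete Comput. Geom. 18 (1997) 305–363, §4.4 (Table 3 p. 351) and
`predicates.c` (`orient3d`, `orient3dadapt`, `estimate`) [Shewchuk1997].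
-/

namespace Summit.Ventures.CertifiedArithmetic.Expansions

open Literature.ComputerArithmetic.JeannerodRump2018
open Literature.ComputerArithmetic.BoldoJeannerodMelquiondMuller2023 hiding twoSum twoSum_fst
  isFloat_twoSum
open Literature.ComputerArithmetic.Shewchuk1997

variable {p : ℕ} {emin : ℤ} {fl : ℚ → ℚ}

/-! ## Rational inequalities -/

/-- Sign transfer: if `|a − b| < |b|` then `a` and `b` are both positive or both negative. -/
theorem pos_iff_and_neg_iff_of_abs_sub_lt {a b : ℚ} (h : |a - b| < |b|) :
    (0 < b ↔ 0 < a) ∧ (b < 0 ↔ a < 0) := by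
  obtain ⟨hl, hr⟩ := abs_sub_lt_iff.mp h
  have hb : b ≠ 0 := by
    rintro rfl
    rw [abs_zero] at h
    exact absurd h (not_lt.mpr (abs_nonneg _))
  rcases lt_or_gt_of_ne hb with hneg | hpos
  · rw [abs_of_neg hneg] at hl hr
    exact ⟨⟨fun h' => absurd hneg (not_lt.mpr h'.le), fun h' => by linarith⟩,
      ⟨fun _ => by linarith, fun _ => hneg⟩⟩
  · rw [abs_of_pos hpos] at hl hr
    exact ⟨⟨fun _ => by linarith, fun _ => hpos⟩,
      ⟨fun h' => absurd hpos (not_lt.mpr h'.le), fun h' => by linarith⟩⟩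

/-- **One cofactor term, true vs computed differences.**  If `yᵢ = zᵢ ± ε|zᵢ|` (`i = 0..4`) then
`|y₀(y₁y₂ − y₃y₄) − z₀(z₁z₂ − z₃z₄)| ≤ (3ε + 3ε² + ε³)·|z₀|(|z₁z₂| + |z₃z₄|)`
(each product of three perturbed factors is off by `(1 + ε)³ − 1` of itself). -/
theorem cofactorB_sub_le_of_rel {u y₀ y₁ y₂ y₃ y₄ z₀ z₁ z₂ z₃ z₄ : ℚ} (hu : 0 ≤ u)
    (h₀ : |y₀ - z₀| ≤ u * |z₀|) (h₁ : |y₁ - z₁| ≤ u * |z₁|) (h₂ : |y₂ - z₂| ≤ u * |z₂|)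
    (h₃ : |y₃ - z₃| ≤ u * |z₃|) (h₄ : |y₄ - z₄| ≤ u * |z₄|) :
    |y₀ * (y₁ * y₂ - y₃ * y₄) - z₀ * (z₁ * z₂ - z₃ * z₄)| ≤
      (3 * u + 3 * u ^ 2 + u ^ 3) * (|z₀| * (|z₁ * z₂| + |z₃ * z₄|)) := by
  have e₁ := abs_mul_sub_mul_le_of_rel hu h₁ h₂
  have e₂ := abs_mul_sub_mul_le_of_rel hu h₃ h₄
  set S := |z₁ * z₂| + |z₃ * z₄| with hS
  have hS0 : 0 ≤ S := by rw [hS]; positivity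
  have hm : |(y₁ * y₂ - y₃ * y₄) - (z₁ * z₂ - z₃ * z₄)| ≤ (2 * u + u ^ 2) * S := by
    have hdec : (y₁ * y₂ - y₃ * y₄) - (z₁ * z₂ - z₃ * z₄) =
        (y₁ * y₂ - z₁ * z₂) - (y₃ * y₄ - z₃ * z₄) := by ring
    rw [hdec]
    calc |(y₁ * y₂ - z₁ * z₂) - (y₃ * y₄ - z₃ * z₄)|
          ≤ |y₁ * y₂ - z₁ * z₂| + |y₃ * y₄ - z₃ * z₄| := abs_sub _ _
      _ ≤ (2 * u + u ^ 2) * |z₁ * z₂| + (2 * u + u ^ 2) * |z₃ * z₄| := add_le_add e₁ e₂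
      _ = (2 * u + u ^ 2) * S := by rw [hS]; ring
  have hmabs : |y₁ * y₂ - y₃ * y₄| ≤ (1 + 2 * u + u ^ 2) * S := by
    have h1 := abs_sub_abs_le_abs_sub (y₁ * y₂ - y₃ * y₄) (z₁ * z₂ - z₃ * z₄)
    have h2 : |z₁ * z₂ - z₃ * z₄| ≤ S := abs_sub _ _
    linarith
  have hdec : y₀ * (y₁ * y₂ - y₃ * y₄) - z₀ * (z₁ * z₂ - z₃ * z₄) =
      (y₀ - z₀) * (y₁ * y₂ - y₃ * y₄) + z₀ * ((y₁ * y₂ - y₃ * y₄) - (z₁ * z₂ - z₃ * z₄)) := by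
    ring
  rw [hdec]
  calc |(y₀ - z₀) * (y₁ * y₂ - y₃ * y₄) + z₀ * ((y₁ * y₂ - y₃ * y₄) - (z₁ * z₂ - z₃ * z₄))|
        ≤ |(y₀ - z₀) * (y₁ * y₂ - y₃ * y₄)| + |z₀ * ((y₁ * y₂ - y₃ * y₄) - (z₁ * z₂ - z₃ * z₄))| :=
        abs_add_le _ _
    _ = |y₀ - z₀| * |y₁ * y₂ - y₃ * y₄| + |z₀| * |(y₁ * y₂ - y₃ * y₄) - (z₁ * z₂ - z₃ * z₄)| := by
        rw [abs_mul, abs_mul]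
    _ ≤ u * |z₀| * ((1 + 2 * u + u ^ 2) * S) + |z₀| * ((2 * u + u ^ 2) * S) :=
        add_le_add (mul_le_mul h₀ hmabs (abs_nonneg _) (by positivity))
          (mul_le_mul_of_nonneg_left hm (abs_nonneg _))
    _ = (3 * u + 3 * u ^ 2 + u ^ 3) * (|z₀| * S) := by ring

/-- **The computed bound is not too small** (the `permanent` chain of `orient3d`, five roundings
deep, then `errbound = K ⊗ permanent`): with `S_a, S_b, S_c ≥ 0` the exact sums `|P| + |P'|`,
`A = fl(S)`, `α = fl(A·|z|)`, `W₁ = fl(α_a + α_b)`, `W = fl(W₁ + α_c)`, `E = fl(K·W)`, each with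
relative error `ε` w.r.t. the true operands, `E ≥ (1 − ε)⁵·K·(|z_a|S_a + |z_b|S_b + |z_c|S_c)`. -/
theorem orient3dPermanent_ge {u K Sa Sb Sc za zb zc Aa Ab Ac αa αb αc W₁ W E : ℚ}
    (hu0 : 0 ≤ u) (hu1 : u ≤ 1) (hK0 : 0 ≤ K) (hSa0 : 0 ≤ Sa) (hSb0 : 0 ≤ Sb) (hSc0 : 0 ≤ Sc)
    (hAa : |Sa - Aa| ≤ u * |Sa|) (hAb : |Sb - Ab| ≤ u * |Sb|) (hAc : |Sc - Ac| ≤ u * |Sc|)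
    (hαa : |(Aa * |za|) - αa| ≤ u * |(Aa * |za|)|) (hαb : |(Ab * |zb|) - αb| ≤ u * |(Ab * |zb|)|)
    (hαc : |(Ac * |zc|) - αc| ≤ u * |(Ac * |zc|)|)
    (hW₁ : |(αa + αb) - W₁| ≤ u * |αa + αb|) (hW : |(W₁ + αc) - W| ≤ u * |W₁ + αc|)
    (hE : |K * W - E| ≤ u * |K * W|) :
    (1 - u) ^ 5 * K * (|za| * Sa + |zb| * Sb + |zc| * Sc) ≤ E := by
  have h1u : 0 ≤ 1 - u := by linarith
  have hA : ∀ {S A : ℚ}, 0 ≤ S → |S - A| ≤ u * |S| → (1 - u) * S ≤ A := by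
    intro S A hS h
    have h' := (abs_sub_le_iff.mp h).1
    rw [abs_of_nonneg hS] at h'
    linarith
  have hAa1 := hA hSa0 hAa
  have hAb1 := hA hSb0 hAb
  have hAc1 := hA hSc0 hAc
  have hAa0 : 0 ≤ Aa := le_trans (mul_nonneg h1u hSa0) hAa1
  have hAb0 : 0 ≤ Ab := le_trans (mul_nonneg h1u hSb0) hAb1
  have hAc0 : 0 ≤ Ac := le_trans (mul_nonneg h1u hSc0) hAc1
  have hα : ∀ {S A z α : ℚ}, 0 ≤ S → (1 - u) * S ≤ A → 0 ≤ A →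
      |(A * |z|) - α| ≤ u * |(A * |z|)| → (1 - u) ^ 2 * (|z| * S) ≤ α := by
    intro S A z α hS hA1 hA0 h
    have h' := (abs_sub_le_iff.mp h).1
    rw [abs_of_nonneg (mul_nonneg hA0 (abs_nonneg z))] at h'
    calc (1 - u) ^ 2 * (|z| * S) = (1 - u) * |z| * ((1 - u) * S) := by ring
      _ ≤ (1 - u) * |z| * A := mul_le_mul_of_nonneg_left hA1 (mul_nonneg h1u (abs_nonneg _))
      _ = (1 - u) * (A * |z|) := by ring
      _ ≤ α := by linarith
  have hαa1 := hα hSa0 hAa1 hAa0 hαa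
  have hαb1 := hα hSb0 hAb1 hAb0 hαb
  have hαc1 := hα hSc0 hAc1 hAc0 hαc
  have h1u2 : 0 ≤ (1 - u) ^ 2 := pow_nonneg h1u 2
  have hαa0 : 0 ≤ αa := le_trans (mul_nonneg h1u2 (mul_nonneg (abs_nonneg _) hSa0)) hαa1
  have hαb0 : 0 ≤ αb := le_trans (mul_nonneg h1u2 (mul_nonneg (abs_nonneg _) hSb0)) hαb1
  have hαc0 : 0 ≤ αc := le_trans (mul_nonneg h1u2 (mul_nonneg (abs_nonneg _) hSc0)) hαc1
  have hW₁1 : (1 - u) * (αa + αb) ≤ W₁ := by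
    have h := (abs_sub_le_iff.mp hW₁).1
    rw [abs_of_nonneg (add_nonneg hαa0 hαb0)] at h
    linarith
  have hW₁0 : 0 ≤ W₁ := le_trans (mul_nonneg h1u (add_nonneg hαa0 hαb0)) hW₁1
  have hW1 : (1 - u) * (W₁ + αc) ≤ W := by
    have h := (abs_sub_le_iff.mp hW).1
    rw [abs_of_nonneg (add_nonneg hW₁0 hαc0)] at h
    linarith
  have hW0 : 0 ≤ W := le_trans (mul_nonneg h1u (add_nonneg hW₁0 hαc0)) hW1
  have hW2 : (1 - u) ^ 4 * (|za| * Sa + |zb| * Sb + |zc| * Sc) ≤ W := by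
    have h2 : (1 - u) ^ 4 * (|zc| * Sc) ≤ (1 - u) * αc := by
      calc (1 - u) ^ 4 * (|zc| * Sc) = (1 - u) ^ 2 * ((1 - u) ^ 2 * (|zc| * Sc)) := by ring
        _ ≤ (1 - u) ^ 2 * αc := mul_le_mul_of_nonneg_left hαc1 h1u2
        _ ≤ (1 - u) * αc := by
            have h : (1 - u) ^ 2 ≤ 1 - u := by nlinarith
            exact mul_le_mul_of_nonneg_right h hαc0
    have h3 : (1 - u) ^ 4 * (|za| * Sa + |zb| * Sb) ≤ (1 - u) * W₁ := by
      calc (1 - u) ^ 4 * (|za| * Sa + |zb| * Sb)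
            = (1 - u) ^ 2 * ((1 - u) ^ 2 * (|za| * Sa) + (1 - u) ^ 2 * (|zb| * Sb)) := by ring
        _ ≤ (1 - u) ^ 2 * (αa + αb) := mul_le_mul_of_nonneg_left (add_le_add hαa1 hαb1) h1u2
        _ = (1 - u) * ((1 - u) * (αa + αb)) := by ring
        _ ≤ (1 - u) * W₁ := mul_le_mul_of_nonneg_left hW₁1 h1u
    have h4 : (1 - u) ^ 4 * (|za| * Sa + |zb| * Sb + |zc| * Sc)
        = (1 - u) ^ 4 * (|za| * Sa + |zb| * Sb) + (1 - u) ^ 4 * (|zc| * Sc) := by ring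
    have h5 : (1 - u) * W₁ + (1 - u) * αc = (1 - u) * (W₁ + αc) := by ring
    linarith
  have hE1 : (1 - u) * (K * W) ≤ E := by
    have h := (abs_sub_le_iff.mp hE).1
    rw [abs_of_nonneg (mul_nonneg hK0 hW0)] at h
    linarith
  calc (1 - u) ^ 5 * K * (|za| * Sa + |zb| * Sb + |zc| * Sc)
        = (1 - u) * (K * ((1 - u) ^ 4 * (|za| * Sa + |zb| * Sb + |zc| * Sc))) := by ring
    _ ≤ (1 - u) * (K * W) := mul_le_mul_of_nonneg_left (mul_le_mul_of_nonneg_left hW2 hK0) h1u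
    _ ≤ E := hE1

/-- **The sign test of ORIENT3D's stage B is sound, as an inequality between rationals, for any
constant `K` and estimate error `δ` satisfying the margin.**  Data: `0 < ε ≤ 1/2`, `0 ≤ δ < 1`,
`(1 + δ)(3ε + 6ε² + 4ε³ + ε⁴) < (1 − ε)⁵K`; the true differences `t = x ± ε|x|` of the nine computed
ones; six computed products `x·x' = P ± ε|P|`; the permanent chain of `orient3dPermanent_ge`
(`A = fl(|P| + |P'|)`, `α = fl(A|z|)`, `W₁`, `W`, `E = fl(K W)`, relative errors `ε`); an
approximation `det` of `B :=` the determinant of the computed differences with `|det − B| ≤ δ|B|`;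
and the passed test `E ≤ |det|`.  Then `B` has the sign of the true determinant `T` (strictly, both
ways), and so has `det`. -/
theorem orient3d_stageB_sign_of_bounds
    {u K δ ta₁ ta₂ ta₃ tb₁ tb₂ tb₃ tc₁ tc₂ tc₃ xa₁ xa₂ xa₃ xb₁ xb₂ xb₃ xc₁ xc₂ xc₃
      P₁ P₂ P₃ P₄ P₅ P₆ det Aa Ab Ac αa αb αc W₁ W E : ℚ}
    (hu0 : 0 < u) (hu1 : u ≤ 1 / 2) (hδ : 0 ≤ δ) (hδ1 : δ < 1)
    (hmargin : (1 + δ) * (3 * u + 6 * u ^ 2 + 4 * u ^ 3 + u ^ 4) < (1 - u) ^ 5 * K)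
    (ha₁ : |ta₁ - xa₁| ≤ u * |xa₁|) (ha₂ : |ta₂ - xa₂| ≤ u * |xa₂|)
    (ha₃ : |ta₃ - xa₃| ≤ u * |xa₃|) (hb₁ : |tb₁ - xb₁| ≤ u * |xb₁|)
    (hb₂ : |tb₂ - xb₂| ≤ u * |xb₂|) (hb₃ : |tb₃ - xb₃| ≤ u * |xb₃|)
    (hc₁ : |tc₁ - xc₁| ≤ u * |xc₁|) (hc₂ : |tc₂ - xc₂| ≤ u * |xc₂|)
    (hc₃ : |tc₃ - xc₃| ≤ u * |xc₃|)
    (hP₁ : |xb₁ * xc₂ - P₁| ≤ u * |P₁|) (hP₂ : |xc₁ * xb₂ - P₂| ≤ u * |P₂|)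
    (hP₃ : |xc₁ * xa₂ - P₃| ≤ u * |P₃|) (hP₄ : |xa₁ * xc₂ - P₄| ≤ u * |P₄|)
    (hP₅ : |xa₁ * xb₂ - P₅| ≤ u * |P₅|) (hP₆ : |xb₁ * xa₂ - P₆| ≤ u * |P₆|)
    (hAa : |(|P₁| + |P₂|) - Aa| ≤ u * |(|P₁| + |P₂|)|)
    (hAb : |(|P₃| + |P₄|) - Ab| ≤ u * |(|P₃| + |P₄|)|)
    (hAc : |(|P₅| + |P₆|) - Ac| ≤ u * |(|P₅| + |P₆|)|)
    (hαa : |(Aa * |xa₃|) - αa| ≤ u * |(Aa * |xa₃|)|)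
    (hαb : |(Ab * |xb₃|) - αb| ≤ u * |(Ab * |xb₃|)|)
    (hαc : |(Ac * |xc₃|) - αc| ≤ u * |(Ac * |xc₃|)|)
    (hW₁ : |(αa + αb) - W₁| ≤ u * |αa + αb|) (hW : |(W₁ + αc) - W| ≤ u * |W₁ + αc|)
    (hE : |K * W - E| ≤ u * |K * W|)
    (hdet : |det - (xa₃ * (xb₁ * xc₂ - xc₁ * xb₂) + xb₃ * (xc₁ * xa₂ - xa₁ * xc₂)
        + xc₃ * (xa₁ * xb₂ - xb₁ * xa₂))| ≤ δ * |xa₃ * (xb₁ * xc₂ - xc₁ * xb₂)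
        + xb₃ * (xc₁ * xa₂ - xa₁ * xc₂) + xc₃ * (xa₁ * xb₂ - xb₁ * xa₂)|)
    (htest : E ≤ |det|) :
    ((0 < xa₃ * (xb₁ * xc₂ - xc₁ * xb₂) + xb₃ * (xc₁ * xa₂ - xa₁ * xc₂)
          + xc₃ * (xa₁ * xb₂ - xb₁ * xa₂) ↔
        0 < ta₃ * (tb₁ * tc₂ - tc₁ * tb₂) + tb₃ * (tc₁ * ta₂ - ta₁ * tc₂)
          + tc₃ * (ta₁ * tb₂ - tb₁ * ta₂)) ∧
      (xa₃ * (xb₁ * xc₂ - xc₁ * xb₂) + xb₃ * (xc₁ * xa₂ - xa₁ * xc₂)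
          + xc₃ * (xa₁ * xb₂ - xb₁ * xa₂) < 0 ↔
        ta₃ * (tb₁ * tc₂ - tc₁ * tb₂) + tb₃ * (tc₁ * ta₂ - ta₁ * tc₂)
          + tc₃ * (ta₁ * tb₂ - tb₁ * ta₂) < 0)) ∧
      ((0 < xa₃ * (xb₁ * xc₂ - xc₁ * xb₂) + xb₃ * (xc₁ * xa₂ - xa₁ * xc₂)
          + xc₃ * (xa₁ * xb₂ - xb₁ * xa₂) ↔ 0 < det) ∧
        (xa₃ * (xb₁ * xc₂ - xc₁ * xb₂) + xb₃ * (xc₁ * xa₂ - xa₁ * xc₂)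
          + xc₃ * (xa₁ * xb₂ - xb₁ * xa₂) < 0 ↔ det < 0)) := by
  set B := xa₃ * (xb₁ * xc₂ - xc₁ * xb₂) + xb₃ * (xc₁ * xa₂ - xa₁ * xc₂)
    + xc₃ * (xa₁ * xb₂ - xb₁ * xa₂) with hB
  set T := ta₃ * (tb₁ * tc₂ - tc₁ * tb₂) + tb₃ * (tc₁ * ta₂ - ta₁ * tc₂)
    + tc₃ * (ta₁ * tb₂ - tb₁ * ta₂) with hT
  set g := 3 * u + 3 * u ^ 2 + u ^ 3 with hg
  set Sa := |P₁| + |P₂| with hSa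
  set Sb := |P₃| + |P₄| with hSb
  set Sc := |P₅| + |P₆| with hSc
  have hSa0 : 0 ≤ Sa := by rw [hSa]; positivity
  have hSb0 : 0 ≤ Sb := by rw [hSb]; positivity
  have hSc0 : 0 ≤ Sc := by rw [hSc]; positivity
  have h1u : 0 < 1 - u := by linarith
  have hg0 : 0 ≤ g := by rw [hg]; positivity
  -- `K ≥ 0` from the margin
  have hK0 : 0 ≤ K := by
    by_contra hK
    push Not at hK
    have h1 : (1 - u) ^ 5 * K < 0 := mul_neg_of_pos_of_neg (pow_pos h1u 5) hK
    have h2 : 0 ≤ (1 + δ) * (3 * u + 6 * u ^ 2 + 4 * u ^ 3 + u ^ 4) := by positivity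
    linarith
  -- exact products vs computed products: `|x x'| ≤ (1 + ε)|P|`
  have hxP : ∀ {x y P : ℚ}, |x * y - P| ≤ u * |P| → |x * y| ≤ (1 + u) * |P| := by
    intro x y P h
    have := abs_sub_abs_le_abs_sub (x * y) P
    linarith
  -- `|T − B| ≤ g·Π_exact ≤ g(1 + ε)·Π_P`
  have ea := cofactorB_sub_le_of_rel hu0.le ha₃ hb₁ hc₂ hc₁ hb₂
  have eb := cofactorB_sub_le_of_rel hu0.le hb₃ hc₁ ha₂ ha₁ hc₂
  have ec := cofactorB_sub_le_of_rel hu0.le hc₃ ha₁ hb₂ hb₁ ha₂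
  have hTB : |T - B| ≤ g * (1 + u) * (|xa₃| * Sa + |xb₃| * Sb + |xc₃| * Sc) := by
    have hdec : T - B = (ta₃ * (tb₁ * tc₂ - tc₁ * tb₂) - xa₃ * (xb₁ * xc₂ - xc₁ * xb₂))
        + (tb₃ * (tc₁ * ta₂ - ta₁ * tc₂) - xb₃ * (xc₁ * xa₂ - xa₁ * xc₂))
        + (tc₃ * (ta₁ * tb₂ - tb₁ * ta₂) - xc₃ * (xa₁ * xb₂ - xb₁ * xa₂)) := by
      rw [hT, hB]; ring
    rw [hdec]
    have h3 := abs_add_three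
      (ta₃ * (tb₁ * tc₂ - tc₁ * tb₂) - xa₃ * (xb₁ * xc₂ - xc₁ * xb₂))
      (tb₃ * (tc₁ * ta₂ - ta₁ * tc₂) - xb₃ * (xc₁ * xa₂ - xa₁ * xc₂))
      (tc₃ * (ta₁ * tb₂ - tb₁ * ta₂) - xc₃ * (xa₁ * xb₂ - xb₁ * xa₂))
    have pa : |xa₃| * (|xb₁ * xc₂| + |xc₁ * xb₂|) ≤ (1 + u) * (|xa₃| * Sa) := by
      have h := add_le_add (hxP hP₁) (hxP hP₂)
      calc |xa₃| * (|xb₁ * xc₂| + |xc₁ * xb₂|) ≤ |xa₃| * ((1 + u) * |P₁| + (1 + u) * |P₂|) :=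
            mul_le_mul_of_nonneg_left h (abs_nonneg _)
        _ = (1 + u) * (|xa₃| * Sa) := by rw [hSa]; ring
    have pb : |xb₃| * (|xc₁ * xa₂| + |xa₁ * xc₂|) ≤ (1 + u) * (|xb₃| * Sb) := by
      have h := add_le_add (hxP hP₃) (hxP hP₄)
      calc |xb₃| * (|xc₁ * xa₂| + |xa₁ * xc₂|) ≤ |xb₃| * ((1 + u) * |P₃| + (1 + u) * |P₄|) :=
            mul_le_mul_of_nonneg_left h (abs_nonneg _)
        _ = (1 + u) * (|xb₃| * Sb) := by rw [hSb]; ring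
    have pc : |xc₃| * (|xa₁ * xb₂| + |xb₁ * xa₂|) ≤ (1 + u) * (|xc₃| * Sc) := by
      have h := add_le_add (hxP hP₅) (hxP hP₆)
      calc |xc₃| * (|xa₁ * xb₂| + |xb₁ * xa₂|) ≤ |xc₃| * ((1 + u) * |P₅| + (1 + u) * |P₆|) :=
            mul_le_mul_of_nonneg_left h (abs_nonneg _)
        _ = (1 + u) * (|xc₃| * Sc) := by rw [hSc]; ring
    have qa := ea.trans (mul_le_mul_of_nonneg_left pa hg0)
    have qb := eb.trans (mul_le_mul_of_nonneg_left pb hg0)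
    have qc := ec.trans (mul_le_mul_of_nonneg_left pc hg0)
    have hsum : g * ((1 + u) * (|xa₃| * Sa)) + g * ((1 + u) * (|xb₃| * Sb))
        + g * ((1 + u) * (|xc₃| * Sc)) = g * (1 + u) * (|xa₃| * Sa + |xb₃| * Sb + |xc₃| * Sc) := by
      ring
    linarith
  -- the computed bound
  have hE2 : (1 - u) ^ 5 * K * (|xa₃| * Sa + |xb₃| * Sb + |xc₃| * Sc) ≤ E :=
    orient3dPermanent_ge hu0.le (by linarith) hK0 hSa0 hSb0 hSc0 hAa hAb hAc hαa hαb hαc hW₁ hW hE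
  -- `|det| ≤ (1 + δ)|B|`
  have hdetB : |det| ≤ (1 + δ) * |B| := by
    have := abs_sub_abs_le_abs_sub det B
    linarith
  -- the margin: `g(1+ε)Π(1+δ) < (1−ε)⁵KΠ ≤ E ≤ |det| ≤ (1+δ)|B|`, unless `Π = 0`
  have hPi0 : 0 ≤ |xa₃| * Sa + |xb₃| * Sb + |xc₃| * Sc := by positivity
  have hgid : g * (1 + u) = 3 * u + 6 * u ^ 2 + 4 * u ^ 3 + u ^ 4 := by rw [hg]; ring
  have hBT : (0 < B ↔ 0 < T) ∧ (B < 0 ↔ T < 0) := by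
    rcases hPi0.lt_or_eq with hPi | hPi
    · -- `Π > 0`: the margin gives `|T − B| < |B|`
      have h1 : (1 + δ) * (g * (1 + u) * (|xa₃| * Sa + |xb₃| * Sb + |xc₃| * Sc))
          < (1 - u) ^ 5 * K * (|xa₃| * Sa + |xb₃| * Sb + |xc₃| * Sc) := by
        have := mul_lt_mul_of_pos_right hmargin hPi
        calc (1 + δ) * (g * (1 + u) * (|xa₃| * Sa + |xb₃| * Sb + |xc₃| * Sc))
            = (1 + δ) * (3 * u + 6 * u ^ 2 + 4 * u ^ 3 + u ^ 4)
              * (|xa₃| * Sa + |xb₃| * Sb + |xc₃| * Sc) := by rw [← hgid]; ring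
          _ < (1 - u) ^ 5 * K * (|xa₃| * Sa + |xb₃| * Sb + |xc₃| * Sc) := this
      have h2 : (1 + δ) * |T - B| ≤
          (1 + δ) * (g * (1 + u) * (|xa₃| * Sa + |xb₃| * Sb + |xc₃| * Sc)) :=
        mul_le_mul_of_nonneg_left hTB (by linarith)
      have h3 : (1 + δ) * |T - B| < (1 + δ) * |B| := by linarith
      exact pos_iff_and_neg_iff_of_abs_sub_lt (lt_of_mul_lt_mul_left h3 (by linarith))
    · -- `Π = 0`: then `T = B`
      have hTB0 : |T - B| ≤ 0 := by
        have h := hTB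
        rw [← hPi, mul_zero] at h
        exact h
      have hTBeq : T = B := by
        have h0 : |T - B| = 0 := le_antisymm hTB0 (abs_nonneg _)
        linarith [abs_eq_zero.mp h0]
      rw [hTBeq]
      exact ⟨Iff.rfl, Iff.rfl⟩
  have hBdet : (0 < B ↔ 0 < det) ∧ (B < 0 ↔ det < 0) := by
    by_cases hB0 : B = 0
    · have hd : det = 0 := by
        have h := hdet
        rw [hB0, sub_zero, abs_zero, mul_zero] at h
        exact abs_eq_zero.mp (le_antisymm h (abs_nonneg _))
      rw [hB0, hd]
      exact ⟨Iff.rfl, Iff.rfl⟩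
    · have hBpos : 0 < |B| := abs_pos.mpr hB0
      have h1 : δ * |B| < |B| := by
        calc δ * |B| < 1 * |B| := mul_lt_mul_of_pos_right hδ1 hBpos
          _ = |B| := one_mul _
      exact pos_iff_and_neg_iff_of_abs_sub_lt (lt_of_le_of_lt hdet h1)
  exact ⟨hBT, hBdet⟩

end Summit.Ventures.CertifiedArithmetic.Expansions
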